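import Mathlib
import HarnessLib
import Summits.Ventures.LatticeQCDFlow.Scaling.AcceptanceGiniFloorSharp

/-!
# LatticeQCDFlow / Scaling — the MID-RANK functional of an importance weight on a GENERAL measure
# space: `E_q g = 0` and `E_q g² ≤ 1/3` (three-point symmetrisation, Fubini)

HONEST FRAMING: exact (Metropolis-corrected) sampling algorithms for lattice gauge theory;
figures of merit are autocorrelation/cost numbers at stated couplings and volumes; no
continuum-physics claim.

Venture `LatticeQCDFlow` (cell pub-lqcd), topic `Scaling`; FANOUT row 3 (`s0-u1-a`, S0-B
implementation A, GEN-9).  NEW WORK of the cell, not a published result; NO definition is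
introduced.  This is the measure-theoretic version of the mid-rank toolkit of row 3's finite
`Scaling/AcceptanceGiniFloorSharp.lean` (imported: `real_sign_sub_swap`,
`three_sign_cyclic_le_one`, and — finitely — `sum_midrank_eq_zero`, `sum_midrank_sq_le_third`),
the ingredient of Glasser's `√3·G ≤ CV` and hence of the Gini acceptance floor
`acc ≥ 1 − √((1/ESS − 1)/3)`; Part II of this pair
(`Scaling/AcceptanceGiniFloorIntegral.lean`) draws that floor on a general state space, in row
2's vocabulary, completing the measure-theoretic acceptance-vs-ESS envelope begun in
`Scaling/AcceptanceEssEightNinthsDensities.lean` (`ā ≥ (8/9)·κ`).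

## Setting and what is proved

`(X, μ)` s-finite; `w` measurable, `q > 0` measurable and integrable (`∫ q dμ = 1` where
stated); `b = w/q`; the SIGN KERNEL `s(x, y) = sign(b x − b y)` and the MID-RANK FUNCTIONAL
`g(x) = ∫ s(x, y) q(y) dμ(y) = q(b < b(x)) − q(b > b(x)) ∈ [−1, 1]` (written out, no `def`).

* `measurable_signKernel`, `integrable_signKernel_mul`, `measurable_midrank`,
  `abs_midrank_le_one` (`|g| ≤ 1`);
* **`integral_midrank_mul_eq_zero`** — `∫ g q dμ = 0` (antisymmetry of `s` + Fubini);
* **`integral_midrank_sq_mul_le`** — `∫ g² q dμ ≤ 1/3`: `g(x)² q(x)` is the `(y, z)`-integral of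
  `s(x,y)s(x,z) q(x)q(y)q(z)`; the copies centred at `y` and at `z` have the same triple
  integral (two Fubini swaps each), and pointwise the three add up to at most `q(x)q(y)q(z)`
  (`three_sign_cyclic_le_one`: among three reals a strict middle one contributes `−1`), whose
  triple integral is `1`.  Equality iff the law of `b` under `q μ` has no atoms (then `g(b)` is
  uniform on `[−1, 1]`; not typed).

NOT CLAIMED: anything numerical; nothing re-scored.  `Measurable Real.sign` and `|sign| ≤ 1`
are inlined as `have`s (they exist under `Literature.Analysis.FunctionSpaces`, not imported here).
-/

namespace Summit.Ventures.LatticeQCDFlow.Theory2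

open MeasureTheory Set

section Midrank

variable {X : Type*} [MeasurableSpace X] {μ : Measure X} [SFinite μ] {w q : X → ℝ}

omit [SFinite μ] in
/-- Joint measurability of the sign kernel `(x, y) ↦ sign(b x − b y)`, `b = w/q`. -/
theorem measurable_signKernel (hwm : Measurable w) (hqm : Measurable q) :
    Measurable fun p : X × X => Real.sign (w p.1 / q p.1 - w p.2 / q p.2) := by
  have hb : Measurable fun x => w x / q x := hwm.div hqm
  -- `Real.sign` is measurable: two `ite`s over `(−∞, 0)` and `(0, ∞)` (folklore; inlined)
  have hsign : Measurable Real.sign := by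
    have h : Real.sign = fun r : ℝ => if r < 0 then (-1 : ℝ) else if 0 < r then 1 else 0 := by
      funext r
      rfl
    rw [h]
    exact Measurable.ite measurableSet_Iio measurable_const
      (Measurable.ite measurableSet_Ioi measurable_const measurable_const)
  exact hsign.comp ((hb.comp measurable_fst).sub (hb.comp measurable_snd))

omit [SFinite μ] in
/-- The mid-rank integrand `y ↦ sign(b x − b y) q(y)` is integrable (`|sign| ≤ 1`). -/
theorem integrable_signKernel_mul (hwm : Measurable w) (hq0 : ∀ t, 0 < q t) (hqm : Measurable q)
    (hqi : Integrable q μ) (x : X) :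
    Integrable (fun y => Real.sign (w x / q x - w y / q y) * q y) μ := by
  have hm : Measurable fun y => Real.sign (w x / q x - w y / q y) * q y :=
    ((measurable_signKernel hwm hqm).comp (measurable_const.prodMk measurable_id)).mul hqm
  have hsgn : ∀ r : ℝ, |Real.sign r| ≤ 1 := fun r => by
    rcases Real.sign_apply_eq r with h | h | h <;> rw [h] <;> norm_num
  refine Integrable.mono' hqi hm.aestronglyMeasurable (Filter.Eventually.of_forall fun y => ?_)
  rw [Real.norm_eq_abs, abs_mul, abs_of_pos (hq0 y)]
  exact mul_le_of_le_one_left (hq0 y).le (hsgn _)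

/-- The mid-rank functional `g(x) = ∫ sign(b x − b y) q(y) dμ(y) = q(b < b x) − q(b > b x)` is
measurable. -/
theorem measurable_midrank (hwm : Measurable w) (hqm : Measurable q) :
    Measurable fun x => ∫ y, Real.sign (w x / q x - w y / q y) * q y ∂μ := by
  have hF : Measurable fun z : X × X => Real.sign (w z.1 / q z.1 - w z.2 / q z.2) * q z.2 :=
    (measurable_signKernel hwm hqm).mul (hqm.comp measurable_snd)
  exact (hF.stronglyMeasurable.integral_prod_right (ν := μ)).measurable

omit [SFinite μ] in
/-- `|g(x)| ≤ 1` (`∫ q dμ = 1`). -/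
theorem abs_midrank_le_one (hwm : Measurable w) (hq0 : ∀ t, 0 < q t) (hqm : Measurable q)
    (hqi : Integrable q μ) (hq1 : ∫ z, q z ∂μ = 1) (x : X) :
    |∫ y, Real.sign (w x / q x - w y / q y) * q y ∂μ| ≤ 1 := by
  have hsgn : ∀ r : ℝ, |Real.sign r| ≤ 1 := fun r => by
    rcases Real.sign_apply_eq r with h | h | h <;> rw [h] <;> norm_num
  rw [← Real.norm_eq_abs]
  calc ‖∫ y, Real.sign (w x / q x - w y / q y) * q y ∂μ‖
      ≤ ∫ y, ‖Real.sign (w x / q x - w y / q y) * q y‖ ∂μ := norm_integral_le_integral_norm _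
    _ ≤ ∫ y, q y ∂μ := by
        refine integral_mono (integrable_signKernel_mul hwm hq0 hqm hqi x).norm hqi fun y => ?_
        show ‖Real.sign (w x / q x - w y / q y) * q y‖ ≤ q y
        rw [Real.norm_eq_abs, abs_mul, abs_of_pos (hq0 y)]
        exact mul_le_of_le_one_left (hq0 y).le (hsgn _)
    _ = 1 := hq1

/-- **`E_q g = 0`**: `∫ g(x) q(x) dμ = 0` — the sign kernel is antisymmetric (Fubini). -/
theorem integral_midrank_mul_eq_zero (hwm : Measurable w) (hq0 : ∀ t, 0 < q t)
    (hqm : Measurable q) (hqi : Integrable q μ) :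
    ∫ x, (∫ y, Real.sign (w x / q x - w y / q y) * q y ∂μ) * q x ∂μ = 0 := by
  have hsgn : ∀ r : ℝ, |Real.sign r| ≤ 1 := fun r => by
    rcases Real.sign_apply_eq r with h | h | h <;> rw [h] <;> norm_num
  have hF : Integrable (fun p : X × X => Real.sign (w p.1 / q p.1 - w p.2 / q p.2) * q p.2 * q p.1)
      (μ.prod μ) := by
    refine Integrable.mono' (hqi.mul_prod hqi)
      (((measurable_signKernel hwm hqm).mul (hqm.comp measurable_snd)).mul
        (hqm.comp measurable_fst)).aestronglyMeasurable (Filter.Eventually.of_forall fun p => ?_)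
    rw [Real.norm_eq_abs, abs_mul, abs_mul, abs_of_pos (hq0 p.2), abs_of_pos (hq0 p.1)]
    calc |Real.sign (w p.1 / q p.1 - w p.2 / q p.2)| * q p.2 * q p.1 ≤ 1 * q p.2 * q p.1 :=
          mul_le_mul_of_nonneg_right (mul_le_mul_of_nonneg_right (hsgn _)
            (hq0 _).le) (hq0 _).le
      _ = q p.1 * q p.2 := by ring
  have e1 : ∫ x, (∫ y, Real.sign (w x / q x - w y / q y) * q y ∂μ) * q x ∂μ
      = ∫ x, ∫ y, Real.sign (w x / q x - w y / q y) * q y * q x ∂μ ∂μ :=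
    integral_congr_ae (Filter.Eventually.of_forall fun x => (integral_mul_const _ _).symm)
  have e2 := integral_integral_swap
    (f := fun x y => Real.sign (w x / q x - w y / q y) * q y * q x) hF
  have e3 : ∫ y, ∫ x, Real.sign (w x / q x - w y / q y) * q y * q x ∂μ ∂μ
      = - ∫ y, ∫ x, Real.sign (w y / q y - w x / q x) * q x * q y ∂μ ∂μ := by
    rw [← integral_neg]
    refine integral_congr_ae (Filter.Eventually.of_forall fun y => ?_)
    show _ = -_
    rw [← integral_neg]
    refine integral_congr_ae (Filter.Eventually.of_forall fun x => ?_)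
    show Real.sign (w x / q x - w y / q y) * q y * q x
      = -(Real.sign (w y / q y - w x / q x) * q x * q y)
    rw [real_sign_sub_swap (w y / q y) (w x / q x)]
    ring
  rw [e1]
  linarith [e2, e3]

/-- **`E_q g² ≤ 1/3`**: `∫ g(x)² q(x) dμ ≤ 1/3` — `g(x)² q(x)` is a triple integral of
`sign(b x − b y) sign(b x − b z) q(x)q(y)q(z)`; the three re-centred copies have the same integral
(Fubini) and add up pointwise to at most `q(x)q(y)q(z)` (`three_sign_cyclic_le_one`), whose
integral is `1`.  (The finite `Σ q g² ≤ 1/3` is row 3's `sum_midrank_sq_le_third`.) -/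
theorem integral_midrank_sq_mul_le (hwm : Measurable w) (hq0 : ∀ t, 0 < q t)
    (hqm : Measurable q) (hqi : Integrable q μ) (hq1 : ∫ z, q z ∂μ = 1) :
    ∫ x, (∫ y, Real.sign (w x / q x - w y / q y) * q y ∂μ) ^ 2 * q x ∂μ ≤ 1 / 3 := by
  -- notation: `s x y` the sign kernel, `g` the mid-rank functional
  set s : X → X → ℝ := fun x y => Real.sign (w x / q x - w y / q y) with hs
  set g : X → ℝ := fun x => ∫ y, s x y * q y ∂μ with hg
  have hsm : Measurable fun p : X × X => s p.1 p.2 := measurable_signKernel hwm hqm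
  have hs1 : ∀ x y, |s x y| ≤ 1 := fun x y => by
    show |Real.sign _| ≤ 1
    rcases Real.sign_apply_eq (w x / q x - w y / q y) with h | h | h <;> rw [h] <;> norm_num
  have hgm : Measurable g := measurable_midrank hwm hqm
  have hg1 : ∀ x, |g x| ≤ 1 := fun x => abs_midrank_le_one hwm hq0 hqm hqi hq1 x
  have hgi : ∀ x, Integrable (fun y => s x y * q y) μ := fun x =>
    integrable_signKernel_mul hwm hq0 hqm hqi x
  -- the double kernel `H x y = (s y x q x)(g y q y)`: `|H| ≤ q x q y`
  have hH : Integrable (fun p : X × X => (s p.2 p.1 * q p.1) * (g p.2 * q p.2)) (μ.prod μ) := by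
    refine Integrable.mono' (hqi.mul_prod hqi)
      ((((hsm.comp measurable_swap).mul (hqm.comp measurable_fst)).mul
        ((hgm.comp measurable_snd).mul (hqm.comp measurable_snd))).aestronglyMeasurable)
      (Filter.Eventually.of_forall fun p => ?_)
    rw [Real.norm_eq_abs, abs_mul, abs_mul, abs_mul, abs_of_pos (hq0 p.1), abs_of_pos (hq0 p.2)]
    calc |s p.2 p.1| * q p.1 * (|g p.2| * q p.2) ≤ 1 * q p.1 * (1 * q p.2) :=
          mul_le_mul (mul_le_mul_of_nonneg_right (hs1 _ _) (hq0 _).le)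
            (mul_le_mul_of_nonneg_right (hg1 _) (hq0 _).le)
            (mul_nonneg (abs_nonneg _) (hq0 _).le) (mul_nonneg zero_le_one (hq0 _).le)
      _ = q p.1 * q p.2 := by ring
  -- `g x ^ 2 q x = ∫ y, (s x y q y)(g x q x)`
  have eT : ∀ x, g x ^ 2 * q x = ∫ y, (s x y * q y) * (g x * q x) ∂μ := by
    intro x
    rw [integral_mul_const, sq]
    ring
  -- the swapped copy: `∫ x, ∫ y, H x y = ∫ y, ∫ x, H x y = T`
  have eH : ∫ x, ∫ y, (s y x * q x) * (g y * q y) ∂μ ∂μ = ∫ x, g x ^ 2 * q x ∂μ := by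
    rw [integral_integral_swap (f := fun x y => (s y x * q x) * (g y * q y)) hH]
    exact integral_congr_ae (Filter.Eventually.of_forall fun y => (eT y).symm)
  -- the kernel centred at `z`, as a function of `(y, z)` for fixed `x`
  have hΦ3 : ∀ x, Integrable (fun p : X × X => (s p.2 x * q x) * ((s p.2 p.1 * q p.1) * q p.2))
      (μ.prod μ) := by
    intro x
    refine Integrable.mono' ((hqi.mul_prod hqi).const_mul (q x))
      ((((hsm.comp (measurable_snd.prodMk measurable_const)).mul measurable_const).mul
        (((hsm.comp measurable_swap).mul (hqm.comp measurable_fst)).mul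
          (hqm.comp measurable_snd))).aestronglyMeasurable)
      (Filter.Eventually.of_forall fun p => ?_)
    rw [Real.norm_eq_abs, abs_mul, abs_mul, abs_mul, abs_mul, abs_of_pos (hq0 x),
      abs_of_pos (hq0 p.1), abs_of_pos (hq0 p.2)]
    calc |s p.2 x| * q x * (|s p.2 p.1| * q p.1 * q p.2) ≤ 1 * q x * (1 * q p.1 * q p.2) :=
          mul_le_mul (mul_le_mul_of_nonneg_right (hs1 _ _) (hq0 _).le)
            (mul_le_mul_of_nonneg_right (mul_le_mul_of_nonneg_right (hs1 _ _) (hq0 _).le)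
              (hq0 _).le)
            (mul_nonneg (mul_nonneg (abs_nonneg _) (hq0 _).le) (hq0 _).le)
            (mul_nonneg zero_le_one (hq0 _).le)
      _ = q x * (q p.1 * q p.2) := by ring
  -- inner `z`-integrals in closed form
  have ez1 : ∀ x y, ∫ z, (s x y * q y) * ((s x z * q z) * q x) ∂μ = (s x y * q y) * (g x * q x) := by
    intro x y
    rw [integral_const_mul, integral_mul_const]
  have ez2 : ∀ x y, ∫ z, (s y x * q x) * ((s y z * q z) * q y) ∂μ = (s y x * q x) * (g y * q y) := by
    intro x y
    rw [integral_const_mul, integral_mul_const]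
  -- centred at `z`: swap the inner pair `(y, z)`
  have ez3 : ∀ x, ∫ y, ∫ z, (s z x * q x) * ((s z y * q y) * q z) ∂μ ∂μ
      = ∫ z, (s z x * q x) * (g z * q z) ∂μ := by
    intro x
    rw [integral_integral_swap (f := fun y z => (s z x * q x) * ((s z y * q y) * q z)) (hΦ3 x)]
    refine integral_congr_ae (Filter.Eventually.of_forall fun z => ?_)
    show ∫ y, (s z x * q x) * ((s z y * q y) * q z) ∂μ = (s z x * q x) * (g z * q z)
    rw [integral_const_mul, integral_mul_const]
  -- integrability at the `z`, `y`, `x` levels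
  have hz1 : ∀ x y, Integrable (fun z => (s x y * q y) * ((s x z * q z) * q x)) μ := fun x y =>
    ((hgi x).mul_const _).const_mul _
  have hz2 : ∀ x y, Integrable (fun z => (s y x * q x) * ((s y z * q z) * q y)) μ := fun x y =>
    ((hgi y).mul_const _).const_mul _
  have hz3 : ∀ x y, Integrable (fun z => (s z x * q x) * ((s z y * q y) * q z)) μ := by
    intro x y
    have hm : Measurable fun z => (s z x * q x) * ((s z y * q y) * q z) :=
      ((hsm.comp (measurable_id.prodMk measurable_const)).mul measurable_const).mul
        (((hsm.comp (measurable_id.prodMk measurable_const)).mul measurable_const).mul hqm)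
    refine Integrable.mono' (hqi.const_mul (q x * q y)) hm.aestronglyMeasurable
      (Filter.Eventually.of_forall fun z => ?_)
    rw [Real.norm_eq_abs, abs_mul, abs_mul, abs_mul, abs_mul, abs_of_pos (hq0 x),
      abs_of_pos (hq0 y), abs_of_pos (hq0 z)]
    calc |s z x| * q x * (|s z y| * q y * q z) ≤ 1 * q x * (1 * q y * q z) :=
          mul_le_mul (mul_le_mul_of_nonneg_right (hs1 _ _) (hq0 _).le)
            (mul_le_mul_of_nonneg_right (mul_le_mul_of_nonneg_right (hs1 _ _) (hq0 _).le)
              (hq0 _).le)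
            (mul_nonneg (mul_nonneg (abs_nonneg _) (hq0 _).le) (hq0 _).le)
            (mul_nonneg zero_le_one (hq0 _).le)
      _ = q x * q y * q z := by ring
  have hy1 : ∀ x, Integrable (fun y => ∫ z, (s x y * q y) * ((s x z * q z) * q x) ∂μ) μ := by
    intro x
    simp_rw [ez1]
    exact (hgi x).mul_const _
  have hy2 : ∀ x, Integrable (fun y => ∫ z, (s y x * q x) * ((s y z * q z) * q y) ∂μ) μ := by
    intro x
    simp_rw [ez2]
    have hm : Measurable fun y => (s y x * q x) * (g y * q y) :=
      ((hsm.comp (measurable_id.prodMk measurable_const)).mul measurable_const).mul (hgm.mul hqm)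
    refine Integrable.mono' (hqi.const_mul (q x)) hm.aestronglyMeasurable
      (Filter.Eventually.of_forall fun y => ?_)
    rw [Real.norm_eq_abs, abs_mul, abs_mul, abs_mul, abs_of_pos (hq0 x), abs_of_pos (hq0 y)]
    calc |s y x| * q x * (|g y| * q y) ≤ 1 * q x * (1 * q y) :=
          mul_le_mul (mul_le_mul_of_nonneg_right (hs1 _ _) (hq0 _).le)
            (mul_le_mul_of_nonneg_right (hg1 _) (hq0 _).le)
            (mul_nonneg (abs_nonneg _) (hq0 _).le) (mul_nonneg zero_le_one (hq0 _).le)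
      _ = q x * q y := by ring
  have hy3 : ∀ x, Integrable (fun y => ∫ z, (s z x * q x) * ((s z y * q y) * q z) ∂μ) μ :=
    fun x => (hΦ3 x).integral_prod_left
  -- the three triple integrals all equal `T = ∫ g² q`
  have t1 : ∫ x, g x ^ 2 * q x ∂μ
      = ∫ x, ∫ y, ∫ z, (s x y * q y) * ((s x z * q z) * q x) ∂μ ∂μ ∂μ := by
    refine integral_congr_ae (Filter.Eventually.of_forall fun x => ?_)
    show g x ^ 2 * q x = ∫ y, ∫ z, (s x y * q y) * ((s x z * q z) * q x) ∂μ ∂μ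
    simp_rw [ez1]
    exact eT x
  have t2 : ∫ x, g x ^ 2 * q x ∂μ
      = ∫ x, ∫ y, ∫ z, (s y x * q x) * ((s y z * q z) * q y) ∂μ ∂μ ∂μ := by
    rw [← eH]
    refine integral_congr_ae (Filter.Eventually.of_forall fun x => ?_)
    show ∫ y, (s y x * q x) * (g y * q y) ∂μ = ∫ y, ∫ z, (s y x * q x) * ((s y z * q z) * q y) ∂μ ∂μ
    simp_rw [ez2]
  have t3 : ∫ x, g x ^ 2 * q x ∂μ
      = ∫ x, ∫ y, ∫ z, (s z x * q x) * ((s z y * q y) * q z) ∂μ ∂μ ∂μ := by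
    rw [← eH]
    refine integral_congr_ae (Filter.Eventually.of_forall fun x => ?_)
    show ∫ y, (s y x * q x) * (g y * q y) ∂μ = ∫ y, ∫ z, (s z x * q x) * ((s z y * q y) * q z) ∂μ ∂μ
    rw [ez3 x]
  -- pointwise: the three centred kernels add up to at most `q x q y q z`
  have hpt : ∀ x y z, (s x y * q y) * ((s x z * q z) * q x) + (s y x * q x) * ((s y z * q z) * q y)
      + (s z x * q x) * ((s z y * q y) * q z) ≤ q x * q y * q z := by
    intro x y z
    have h3 : s x y * s x z + s y x * s y z + s z x * s z y ≤ 1 := by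
      have h := three_sign_cyclic_le_one (w x / q x) (w y / q y) (w z / q z)
      simp only [hs]
      linarith
    have hq3 : 0 ≤ q x * q y * q z :=
      mul_nonneg (mul_nonneg (hq0 x).le (hq0 y).le) (hq0 z).le
    calc (s x y * q y) * ((s x z * q z) * q x) + (s y x * q x) * ((s y z * q z) * q y)
          + (s z x * q x) * ((s z y * q y) * q z)
        = (s x y * s x z + s y x * s y z + s z x * s z y) * (q x * q y * q z) := by ring
      _ ≤ 1 * (q x * q y * q z) := mul_le_mul_of_nonneg_right h3 hq3
      _ = q x * q y * q z := one_mul _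
  -- integrate the pointwise bound three times
  have lz : ∀ x y, (∫ z, (s x y * q y) * ((s x z * q z) * q x) ∂μ)
        + (∫ z, (s y x * q x) * ((s y z * q z) * q y) ∂μ)
        + (∫ z, (s z x * q x) * ((s z y * q y) * q z) ∂μ) ≤ q x * q y := by
    intro x y
    have h12 : Integrable (fun z => (s x y * q y) * ((s x z * q z) * q x)
        + (s y x * q x) * ((s y z * q z) * q y)) μ := (hz1 x y).add (hz2 x y)
    rw [← integral_add (hz1 x y) (hz2 x y), ← integral_add h12 (hz3 x y)]
    calc ∫ z, (s x y * q y) * ((s x z * q z) * q x) + (s y x * q x) * ((s y z * q z) * q y)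
            + (s z x * q x) * ((s z y * q y) * q z) ∂μ
        ≤ ∫ z, q x * q y * q z ∂μ := integral_mono (h12.add (hz3 x y)) (hqi.const_mul _) (hpt x y)
      _ = q x * q y := by rw [integral_const_mul, hq1, mul_one]
  have ly : ∀ x, (∫ y, ∫ z, (s x y * q y) * ((s x z * q z) * q x) ∂μ ∂μ)
        + (∫ y, ∫ z, (s y x * q x) * ((s y z * q z) * q y) ∂μ ∂μ)
        + (∫ y, ∫ z, (s z x * q x) * ((s z y * q y) * q z) ∂μ ∂μ) ≤ q x := by
    intro x
    have h12 : Integrable (fun y => (∫ z, (s x y * q y) * ((s x z * q z) * q x) ∂μ)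
        + (∫ z, (s y x * q x) * ((s y z * q z) * q y) ∂μ)) μ := (hy1 x).add (hy2 x)
    rw [← integral_add (hy1 x) (hy2 x), ← integral_add h12 (hy3 x)]
    calc ∫ y, (∫ z, (s x y * q y) * ((s x z * q z) * q x) ∂μ)
            + (∫ z, (s y x * q x) * ((s y z * q z) * q y) ∂μ)
            + (∫ z, (s z x * q x) * ((s z y * q y) * q z) ∂μ) ∂μ
        ≤ ∫ y, q x * q y ∂μ := integral_mono (h12.add (hy3 x)) (hqi.const_mul _) (lz x)
      _ = q x := by rw [integral_const_mul, hq1, mul_one]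
  have hx1 : Integrable (fun x => ∫ y, ∫ z, (s x y * q y) * ((s x z * q z) * q x) ∂μ ∂μ) μ := by
    have e : (fun x => ∫ y, ∫ z, (s x y * q y) * ((s x z * q z) * q x) ∂μ ∂μ)
        = fun x => g x ^ 2 * q x := by
      funext x
      simp_rw [ez1]
      exact (eT x).symm
    rw [e]
    refine Integrable.mono' hqi ((hgm.pow_const 2).mul hqm).aestronglyMeasurable
      (Filter.Eventually.of_forall fun x => ?_)
    rw [Real.norm_eq_abs, abs_mul, abs_of_pos (hq0 x), abs_pow]
    exact mul_le_of_le_one_left (hq0 x).le (pow_le_one₀ (abs_nonneg _) (hg1 x))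
  have hx2 : Integrable (fun x => ∫ y, ∫ z, (s y x * q x) * ((s y z * q z) * q y) ∂μ ∂μ) μ := by
    have e : (fun x => ∫ y, ∫ z, (s y x * q x) * ((s y z * q z) * q y) ∂μ ∂μ)
        = fun x => ∫ y, (s y x * q x) * (g y * q y) ∂μ := by
      funext x
      simp_rw [ez2]
    rw [e]
    exact hH.integral_prod_left
  have hx3 : Integrable (fun x => ∫ y, ∫ z, (s z x * q x) * ((s z y * q y) * q z) ∂μ ∂μ) μ := by
    have e : (fun x => ∫ y, ∫ z, (s z x * q x) * ((s z y * q y) * q z) ∂μ ∂μ)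
        = fun x => ∫ z, (s z x * q x) * (g z * q z) ∂μ := funext ez3
    rw [e]
    exact hH.integral_prod_left
  have lx : (∫ x, ∫ y, ∫ z, (s x y * q y) * ((s x z * q z) * q x) ∂μ ∂μ ∂μ)
        + (∫ x, ∫ y, ∫ z, (s y x * q x) * ((s y z * q z) * q y) ∂μ ∂μ ∂μ)
        + (∫ x, ∫ y, ∫ z, (s z x * q x) * ((s z y * q y) * q z) ∂μ ∂μ ∂μ) ≤ 1 := by
    have h12 : Integrable (fun x => (∫ y, ∫ z, (s x y * q y) * ((s x z * q z) * q x) ∂μ ∂μ)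
        + (∫ y, ∫ z, (s y x * q x) * ((s y z * q z) * q y) ∂μ ∂μ)) μ := hx1.add hx2
    rw [← integral_add hx1 hx2, ← integral_add h12 hx3]
    calc _ ≤ ∫ x, q x ∂μ := integral_mono (h12.add hx3) hqi ly
      _ = 1 := hq1
  rw [← t1, ← t2, ← t3] at lx
  linarith

end Midrank

end Summit.Ventures.LatticeQCDFlow.Theory2
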